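import Summits.HubbardSuperconductivity.HubbardSuperconductivity.Theorems.BalabanIRBirEveryGroundStateStubLiebAnchor
import Literature.MathematicalPhysics.QuantumLattice.HubbardWave0RepulsiveProofs
import Literature.MathematicalPhysics.QuantumLattice.HubbardModelProofs
import HarnessLib

/-!
# Route `JosephsonMirror` — crux `JmCusp` (stmt-HubbardSuperconductivity-2228):
# clause (ii) of the bet HOLDS at half filling for every repulsive coupling

Companion of `JosephsonMirrorJmCuspFreeLayersNotSimple.lean` (clause (ii) — eventual simplicity of
the `(N_L, S^z = 0)` ground state, `N_L = 2⌊(1-δ)L²/2⌋` — is FALSE at `U = 0` for every `δ ∈ (0,1)`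
and TRUE for every `U < 0`).  Here the remaining accessible edge of the bet's quadrant
`{U > 0, 0 < δ < 1/2}`:

* `szSector_groundStates_smul_of_liebTwo` — Lieb's Theorem 2 in sector language: on a connected
  bipartite graph with equinumerous colour classes (`|A| = |B| = n`), `t ≠ 0`, `U > 0`, any two
  ground states of `hamiltonian G t U` in the joint sector `(2n, S^z = 0)` are proportional
  (`LiebTwo.lieb_repulsive_halfFilling_core`: the `2n`-particle ground eigenspace has dimension
  `2S + 1 = 1`; it contains the `S^z = 0` floor by `groundEnergyAt_eq_minEnergyOn_szSector`);
* `two_mul_card_filter_torusStagger_eq_one` — the even torus has equinumerous sublattices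
  (`2·#{ε_x = +1} = L²`, by the sign-flipping unit shift);
* `eventualSimplicity_halfFilling` / `jmCusp_clauseII_holds_at_half_filling` — hence clause (ii)
  with `δ := 0` holds for every `U > 0` and every even `L ≥ 2` (`fermionTorusGraph_connected`,
  `torusStagger_eq_neg_of_adj_holds`).

Net calibration of clause (ii) on the boundary of the bet's quadrant accessible to theorems: TRUE on
`{U < 0}` (Lieb 1) and on `{δ = 0, U > 0}` (Lieb 2), FALSE on `{U = 0, 0 < δ < 1}` (open free
shells); the interior `{U > 0, 0 < δ < 1/2}` is the open content of the bet.

Sources: E. H. Lieb, Phys. Rev. Lett. 62 (1989) 1201, Theorem 2 (proved in tree: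
`lieb_repulsive_halfFilling_holds` / `LiebTwo.lieb_repulsive_halfFilling_core`).  No definitions, no
named facts.
-/

-- the mandated namespace `Summit.<Summit>.<Problem>.Theorems` repeats `HubbardSuperconductivity`
-- (single-problem summit, D-0017), which the `dupNamespace` linter flags on every declaration
set_option linter.dupNamespace false

noncomputable section

namespace Summit.HubbardSuperconductivity.HubbardSuperconductivity.Theorems.JosephsonMirror

open Matrix Finset Literature.MathematicalPhysics.QuantumLattice Literature.Probability.LatticeModels

/-! ### The half-filled edge: clause (ii) HOLDS at `δ = 0` for every `U > 0` (Lieb's Theorem 2) -/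

/-- **Lieb's Theorem 2 with equinumerous sublattices, in sector language** (any connected bipartite
graph with `|A| = |B| = n`, `t ≠ 0`, `U > 0`): any two ground states of `hamiltonian G t U` in the
joint sector `(2n, S^z = 0)` are proportional — the `2n`-particle ground eigenspace has dimension
`2S + 1 = 1` (`S = 0`, `LiebTwo.lieb_repulsive_halfFilling_core`) and contains the `S^z = 0` sector
floor (`groundEnergyAt_eq_minEnergyOn_szSector`). Lieb, PRL 62 (1989) 1201, Theorem 2.
[cite: LiebPRL1989, Theorem 2] -/
theorem szSector_groundStates_smul_of_liebTwo {Λ : Type*} [LinearOrder Λ] [Fintype Λ]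
    (G : SimpleGraph Λ) [DecidableRel G.Adj] (hG : G.Connected) (A : Finset Λ)
    (hA : ∀ x y : Λ, G.Adj x y → (x ∈ A ↔ y ∉ A)) {n : ℕ} (hΛ : Fintype.card Λ = 2 * n)
    (hAn : A.card + 0 = n) {t U : ℝ} (ht : t ≠ 0) (hU : 0 < U) (φ φ' : Fock (Orb Λ))
    (hφ : IsGroundStateInSector (hamiltonian G t U) (2 * n) 0 φ)
    (hφ' : IsGroundStateInSector (hamiltonian G t U) (2 * n) 0 φ') : ∃ c : ℂ, φ' = c • φ := by
  obtain ⟨hrank, -⟩ := LiebTwo.lieb_repulsive_halfFilling_core G hG A hA hΛ hAn t U ht hU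
  have hn_le : n ≤ Fintype.card Λ := by omega
  have hE : (hamiltonian G t U).minEnergyOn (szSector (Λ := Λ) (2 * n) 0) =
      groundEnergy (hamiltonian G t U) (2 * n) :=
    (groundEnergyAt_eq_minEnergyOn_szSector G t U hn_le).symm
  have hmem : ∀ ψ : Fock (Orb Λ), IsGroundStateInSector (hamiltonian G t U) (2 * n) 0 ψ →
      ψ ∈ LinearMap.ker (Matrix.toLin' (hamiltonian G t U -
          ((groundEnergy (hamiltonian G t U) (2 * n) : ℝ) : ℂ) • 1)) ⊓
        LinearMap.ker (Matrix.toLin' (totalNumber - ((2 * n : ℕ) : ℂ) • (1 : Matrix _ _ ℂ))) := by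
    intro ψ hψ
    refine (LiebTwo.mem_groundSector_iff G t U (2 * n) _ ψ).2 ⟨?_, ((mem_szSector_iff _ _ _).1 hψ.1).1⟩
    have h := hψ.2.2
    rw [hE] at h
    exact h
  have hrank1 : Module.finrank ℂ ↥(LinearMap.ker (Matrix.toLin' (hamiltonian G t U -
          ((groundEnergy (hamiltonian G t U) (2 * n) : ℝ) : ℂ) • 1)) ⊓
        LinearMap.ker (Matrix.toLin' (totalNumber - ((2 * n : ℕ) : ℂ) • (1 : Matrix _ _ ℂ)))) = 1 := by
    omega
  have hφ0 : (⟨φ, hmem φ hφ⟩ : ↥(LinearMap.ker (Matrix.toLin' (hamiltonian G t U -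
          ((groundEnergy (hamiltonian G t U) (2 * n) : ℝ) : ℂ) • 1)) ⊓
        LinearMap.ker (Matrix.toLin' (totalNumber - ((2 * n : ℕ) : ℂ) • (1 : Matrix _ _ ℂ))))) ≠ 0 :=
    fun h => hφ.2.1 (congrArg Subtype.val h)
  obtain ⟨c, hc⟩ := (finrank_eq_one_iff_of_nonzero' _ hφ0).1 hrank1 ⟨φ', hmem φ' hφ'⟩
  exact ⟨c, (congrArg Subtype.val hc).symm⟩

/-- **The two sublattices of the even torus are equinumerous**: for even `L` the staggering sign
`ε_x = (-1)^{x₁+x₂}` takes the value `+1` on exactly `L²/2` sites (the unit shift in the first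
coordinate is an injection flipping the sign, `torusStagger_eq_neg_of_toTorusSite_eq`).
Lieb, PRL 62 (1989) 1201 (bipartite lattices with `|A| = |B|`). [folklore] -/
theorem two_mul_card_filter_torusStagger_eq_one {L : ℕ} [NeZero L] (hL : Even L) :
    2 * (univ.filter fun x : FermionTorus 2 L => torusStagger x = 1).card = L ^ 2 := by
  set A : Finset (FermionTorus 2 L) := univ.filter fun x : FermionTorus 2 L => torusStagger x = 1 with hA
  -- the unit shift in the first coordinate
  set s : FermionTorus 2 L → FermionTorus 2 L := fun x =>
    FermionTorus.ofTorusSite (FermionTorus.toTorusSite x + Pi.single (0 : Fin 2) 1) with hs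
  have hts : ∀ x, FermionTorus.toTorusSite (s x) =
      FermionTorus.toTorusSite x + Pi.single (0 : Fin 2) 1 :=
    fun x => FermionTorus.toTorusSite_ofTorusSite _
  have hs_inj : Function.Injective s := by
    intro x y h
    have h' := congrArg FermionTorus.toTorusSite h
    rw [hts, hts, add_left_inj] at h'
    exact (FermionTorus.equivTorusSite (d := 2) (L := L)).injective h'
  have hflip : ∀ x, torusStagger (s x) = -torusStagger x := fun x =>
    torusStagger_eq_neg_of_toTorusSite_eq hL (hts x)
  have hmemA : ∀ x, x ∈ A ↔ torusStagger x = 1 := fun x => by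
    rw [hA, mem_filter]
    exact ⟨fun h => h.2, fun h => ⟨mem_univ _, h⟩⟩
  have h1 : A.map ⟨s, hs_inj⟩ ⊆ Aᶜ := by
    intro y hy
    rw [mem_map] at hy
    obtain ⟨x, hx, rfl⟩ := hy
    rw [mem_compl, hmemA]
    rw [hmemA] at hx
    change torusStagger (s x) ≠ 1
    rw [hflip, hx]
    exact Int.units_ne_iff_eq_neg.2 rfl
  have h2 : Aᶜ.map ⟨s, hs_inj⟩ ⊆ A := by
    intro y hy
    rw [mem_map] at hy
    obtain ⟨x, hx, rfl⟩ := hy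
    rw [mem_compl, hmemA] at hx
    rw [hmemA]
    change torusStagger (s x) = 1
    rw [hflip, Int.units_ne_iff_eq_neg.1 hx, neg_neg]
  have c1 : A.card ≤ Aᶜ.card := by simpa using card_le_card h1
  have c2 : Aᶜ.card ≤ A.card := by simpa using card_le_card h2
  have hsum : A.card + Aᶜ.card = L ^ 2 := by
    rw [card_add_card_compl]
    simp [FermionTorus, Fintype.card_lex]
  omega

/-- **Clause (ii) holds at half filling for every repulsive coupling.** For `U > 0` and EVERY even
`L ≥ 2`, any two ground states of `hubbardTorus 2 L 1 U` in the joint sector `(L², S^z = 0)` — the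
sector `(2⌊(1-δ)L²/2⌋, S^z = 0)` of the bet at the edge `δ = 0` of its doping window — are
proportional: the even torus is connected (`fermionTorusGraph_connected`) and bipartite
(`torusStagger_eq_neg_of_adj_holds`) with equinumerous sublattices
(`two_mul_card_filter_torusStagger_eq_one`), so `szSector_groundStates_smul_of_liebTwo` applies.
Lieb, PRL 62 (1989) 1201, Theorem 2. [cite: LiebPRL1989, Theorem 2] -/
theorem eventualSimplicity_halfFilling {U : ℝ} (hU : 0 < U) :
    ∃ L₀ : ℕ, ∀ (L : ℕ), Even L → L₀ ≤ L →
      ∀ φ φ' : Fock (Orb (FermionTorus 2 L)),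
        IsGroundStateInSector (hubbardTorus 2 L 1 U) (2 * ⌊(1 - 0) * (L : ℝ) ^ 2 / 2⌋₊) 0 φ →
          IsGroundStateInSector (hubbardTorus 2 L 1 U) (2 * ⌊(1 - 0) * (L : ℝ) ^ 2 / 2⌋₊) 0 φ' →
            ∃ c : ℂ, φ' = c • φ := by
  refine ⟨1, fun L hLe hL φ φ' hφ hφ' => ?_⟩
  haveI : NeZero L := ⟨by omega⟩
  obtain ⟨m, hm⟩ := hLe
  set n : ℕ := 2 * m ^ 2 with hn
  have hfloor : ⌊(1 - 0) * (L : ℝ) ^ 2 / 2⌋₊ = n := by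
    have h : (1 - 0) * (L : ℝ) ^ 2 / 2 = ((n : ℕ) : ℝ) := by
      rw [hn, hm]; push_cast; ring
    rw [h, Nat.floor_natCast]
  rw [hfloor] at hφ hφ'
  have hcard : Fintype.card (FermionTorus 2 L) = 2 * n := by
    rw [hn, hm]
    simp only [FermionTorus, Fintype.card_lex, Fintype.card_fun, Fintype.card_fin]
    ring
  -- the bipartition by the staggering sign
  set A : Finset (FermionTorus 2 L) := univ.filter fun x : FermionTorus 2 L => torusStagger x = 1 with hA
  have hmemA : ∀ x, x ∈ A ↔ torusStagger x = 1 := fun x => by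
    rw [hA, mem_filter]
    exact ⟨fun h => h.2, fun h => ⟨mem_univ _, h⟩⟩
  have hAadj : ∀ x y : FermionTorus 2 L, (fermionTorusGraph 2 L).Adj x y → (x ∈ A ↔ y ∉ A) := by
    intro x y hxy
    have h := torusStagger_eq_neg_of_adj_holds ⟨m, hm⟩ hxy
    rw [hmemA, hmemA, h]
    change -torusStagger y = 1 ↔ torusStagger y ≠ 1
    rw [Int.units_ne_iff_eq_neg, neg_eq_iff_eq_neg]
  have hAc : A.card + 0 = n := by
    have h := two_mul_card_filter_torusStagger_eq_one (L := L) ⟨m, hm⟩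
    rw [← hA] at h
    have hL2 : L ^ 2 = 2 * n := by rw [hn, hm]; ring
    omega
  exact szSector_groundStates_smul_of_liebTwo (fermionTorusGraph 2 L) (fermionTorusGraph_connected 2 L)
    A hAadj hcard hAc one_ne_zero hU φ φ' hφ hφ'

/-- **The half-filled calibration of clause (ii) of the bet** (route `JosephsonMirror`, crux
stmt-HubbardSuperconductivity-2228): at the edge `δ = 0` of the doping window the eventual-simplicity
clause (ii) of `JmCusp` HOLDS for every `U > 0` (Lieb's Theorem 2 on the even torus).  With
`jmCusp_clauseII_fails_at_zero_coupling` and `jmCusp_clauseII_holds_at_attractive_coupling` this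
calibrates (ii) on the whole boundary of the bet's quadrant `{U > 0, 0 < δ < 1/2}` that is
accessible to theorems: TRUE on `{U < 0}` and on `{δ = 0, U > 0}`, FALSE on `{U = 0, 0 < δ}`; the
interior is the open content of the bet. Lieb, PRL 62 (1989) 1201, Theorem 2. [cite: LiebPRL1989, Theorem 2] -/
theorem jmCusp_clauseII_holds_at_half_filling :
    ∀ U : ℝ, 0 < U → ∃ L₀ : ℕ, ∀ (L : ℕ), Even L → L₀ ≤ L →
      ∀ φ φ' : Literature.MathematicalPhysics.QuantumLattice.Fock (Literature.MathematicalPhysics.QuantumLattice.Orb (Literature.MathematicalPhysics.QuantumLattice.FermionTorus 2 L)), Literature.MathematicalPhysics.QuantumLattice.IsGroundStateInSector (Literature.MathematicalPhysics.QuantumLattice.hubbardTorus 2 L 1 U) (2 * ⌊(1 - 0) * (L : ℝ) ^ 2 / 2⌋₊) 0 φ → Literature.MathematicalPhysics.QuantumLattice.IsGroundStateInSector (Literature.MathematicalPhysics.QuantumLattice.hubbardTorus 2 L 1 U) (2 * ⌊(1 - 0) * (L : ℝ) ^ 2 / 2⌋₊) 0 φ' → ∃ c : ℂ, φ' = c •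 φ :=
  fun _ hU => eventualSimplicity_halfFilling hU

end Summit.HubbardSuperconductivity.HubbardSuperconductivity.Theorems.JosephsonMirror

end
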